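/-
Copyright (c) 2026 the pub-hodgecm-mathlib formalisation cell (harness21).  Prover seat hodgecm-mathlib-R90-C10-p04 (g2), SLAB R90-TF, section S1 «Ch. 10∕12 local»,
cell «U4-RAM :182 B_pos (ramified tame)» (line (D-1) of R90-C10-p05 (g2), dealer R90-C10-plan (g2) R-S1-22): brick (6a), PART 2 «THE INNER INTEGRALS OF THE GAUSS SQUARE» for
the U4Keys socket :182 ∕ (S-RT) (ramified `χ₁` of positive depth, Branch B, tame ramified place), crux H413 = `stmt-HodgeConjecture-24833`.  KERNEL module: THEOREMS ONLY (no
definition, no named fact, no `sorry`, no instance, no notation).  2026-09-05.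
-/
import Summits.HodgeConjecture.HodgeConjecture.Theorems.R90S1BposRamSkewSphereByFixedUnits     -- ★∕📤 (6a) PART 1 (this seat): parity, the parametrisation `M : c ↦ s₀c`, push-forwards, the algebra of `Ē`; brings ★∕📤 the tool file `R90S1BposRamFixedUnitsHaar` and ★ (B-4) PART 1
import Summits.HodgeConjecture.HodgeConjecture.Theorems.R90S1BposRamSkewBallCharacterIntegral  -- ★ (B-10)(5a) p864139 (R90-C10-p07 (g2)): LEMMA S `setIntegral_skewBall_pow_diteInv_one_add_eq_zero` (the ball of `Ē(1 + t)` at level `|Π|ᵐ` vanishes below the conductor)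
import HarnessLib

/-!
# R90 · S1 ∕ U4Keys leaf (U4f-χ₁-ram-one-pos), BRANCH B, TAME RAMIFIED — brick (6a), PART 2: THE INNER INTEGRALS OF THE GAUSS SQUARE
# `∫_{S₁} Ē(a − s) dμ⁻ = χ₁(−s₀)⁻¹ ∫_C χ₁(ĉ)⁻¹ Ē(1 + u c⁻¹) dν` (`u = −a s₀⁻¹`), `I(e) := ∫_C Ē(1 + u(1+e)c) dν = −ν(𝔪⁺)` resp. `ν(C)`, and the masses `ν ↔ μ⁻`   [Keys1984 §4–§5, §7 Thm (2); WeilBNT1967 Ch. II §5]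

Cell `pub/hodgecm-mathlib` (D-0151), SLAB R90-TF, section S1 «Ch. 10∕12 local», crux H413 = `stmt-HodgeConjecture-24833` (lane `--supports … --as helper`), route of record
`HCCMUnconditional` (no route verbs); prover seat `hodgecm-mathlib-R90-C10-p04` (g2), card (6a) `R90S1BposRamGaussSphere` (dealer R-S1-22; HEADS 01:32:31Z; p01 (g3) «=» 01:35:01Z).
THEOREMS ONLY (no `def`, no `instance`, no notation, no named-fact hypothesis, no `sorry`); ★-only imports (no `Lines` import).  NOT THE PAYER of :182 ∕ (S-RT).

FRAME = PART 1 (`R`, `σ`, `R⁺`, `R⁻`, `μ⁻ = μY` regular additive Haar on `R⁻`, tame ramified `he`, `h2w`; `Ē r = χ₁(r̂)⁻¹` inline with the `(((χ₁ h.unit)⁻¹ : ℂˣ) : ℂ)` bytes of ★ (5a);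
`E r = χ₁(r̂)`).  LETTERS (C-pack bytes, p01 (g3) currency note (i)): `{ϖ} (hϖ : |ϖ| = exp(−1)) {m} (hm : 1 ≤ m)`, conductor `hcond` at `|ϖ|^(m+1)`, sharp witness `u₁` at `|ϖ|^m`
(`n = cond χ₁ = m + 1`); `hfixP` (★ p863838: `χ₁ = 1` on the `σ`-fixed principal units).  A skew base point `δ ∈ Rˣ`, `σδ = −δ`, `|δ_w| = exp(−1)` (PART 1 `exists_skew_valued_eq_exp_neg_one`),
`M = mulSkewUnit σ δ : R⁺ ≃ R⁻`, `ν := μ⁻.map M⁻¹` (a regular Haar measure on `R⁺`, PART 1), `C`, `𝒪⁺ = {|c| ≤ 1}`, `𝔪⁺ = {|c| < 1}` in `R⁺`; `S₁ = {s ∈ R⁻ : |s_w| = exp(−1)} = M(C)`.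
THE POINT (PAPER P-ram-1 §1 (P3) at `m = n − 1`, done with integrals; plan = HEADS 01:32:31Z).  For a `σ`-fixed `a` with `|a_w| = |ϖ|^(m+1)` put `u := −aδ⁻¹ ∈ R⁻`, `|u_w| = |ϖ|^m`.
* §1 **`setIntegral_sphere_diteInv_sub_eq`** — TRANSPORT: `∫_{S₁} Ē(a − s) dμ⁻(s) = χ₁(−δ)⁻¹ · ∫_C χ₁(ĉ)⁻¹·Ē(1 + u·c⁻¹) dν(c)` (`a − δc = (−δc)(1 + uc⁻¹)`).
* §2 **`setIntegral_fixedUnits_diteInv_one_add_mul_eq`** — THE INNER INTEGRAL `I(f) := ∫_C Ē(1 + u f c) dν(c)` for a FIXED `f` with `|f_w| ≤ 1`: `= −ν(𝔪⁺)` if `|f_w| = 1` (`C = 𝒪⁺ ∖ 𝔪⁺`;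
  on `𝒪⁺` push forward by `c ↦ (uf)c` to the skew ball `{|t| ≤ |ϖ|^m}` where ★ (5a) gives `0`; on `𝔪⁺` the integrand is `1` because `|c| ≤ exp(−2)` (fixed parity) puts `ufc` below the
  conductor) and `= ν(C)` if `|f_w| < 1` (then `|f| ≤ exp(−2)`).
* §3 **masses**: `measureReal_fixedUnits_eq` (`ν(C) = μ⁻(S₁)`… as needed), `ν(𝒪⁺) = μ⁻{|y| ≤ 1}`, `ν(𝔪⁺) = μ⁻{|y| ≤ exp(−2)}` (parity on both sides), `ν{e : |1 + e| < 1} = ν(𝔪⁺)`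
  (translation by `1`), and the ★ tame-ramified ratio `μ⁻{|y| ≤ exp(−2)} = q⁻¹ μ⁻{|y| ≤ 1}`.
HONEST LABEL.  HC_CM is proved only modulo the 7 printed citations (2 remaining named inputs: hLiu418 = `stmt-HodgeConjecture-24832`, h413 = `stmt-HodgeConjecture-24833`) until rung 0
closes; count-neutral — this file pays NO socket (:182, (S-RT), A2′ stay OPEN); no printed citation is discharged; REL ≠ ★ ≠ BUILT.

## References
* [Keys1984] D. Keys, *Principal series representations of special unitary groups over local fields*, Compositio Math. 51 (1984), §4–§5, §7 Theorem (2) (d) p. 126.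
* [WeilBNT1967] A. Weil, *Basic Number Theory* (1967), Ch. I §2–§4, Ch. II §5.
* [IrelandRosen1990] K. Ireland, M. Rosen, *A Classical Introduction to Modern Number Theory*, GTM 84 (1990), Ch. 8 §2 (the quadratic Gauss sum `g² = ε(−1)q`).
* [SerreLocalFields1979] J.-P. Serre, *Local Fields*, GTM 67 (1979), Ch. IV §2 Prop. 5.
-/

set_option autoImplicit false
-- the mandated namespace has the single-problem summit's repeated segment (`HodgeConjecture.HodgeConjecture`)
set_option linter.dupNamespace false

noncomputable section

open NumberField IsDedekindDomain MeasureTheory Measure Topology Set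
open scoped NNReal ENNReal
open Literature.NumberTheory Literature.NumberTheory.Automorphic Literature.NumberTheory.Automorphic.UnitaryGroup

namespace Summit.HodgeConjecture.HodgeConjecture.R90.S1.BposRamGaussSphereInner

open Summit.HodgeConjecture.HodgeConjecture.Cruxes.H413
open Summit.HodgeConjecture.HodgeConjecture.Cruxes.H413.K2E3BranchBSkewUnitSign
open Summit.HodgeConjecture.HodgeConjecture.Cruxes.H413.K2E3BranchBSkewLineIntegrals
open Summit.HodgeConjecture.HodgeConjecture.Cruxes.H413.K2E3BranchBSkewLineCharacterIntegral
open Summit.HodgeConjecture.HodgeConjecture.R90.S1.BposSkewBallCharacterTools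
open Summit.HodgeConjecture.HodgeConjecture.R90.S1.BposRamFixedUnitsHaar
open Summit.HodgeConjecture.HodgeConjecture.R90.S1.BposRamSkewSphereByFixedUnits
open Summit.HodgeConjecture.HodgeConjecture.R90.S1.BposRamSkewBallCharacterIntegral

variable (L : Type) [Field L] [NumberField L] [IsCMField L] (v : HeightOneSpectrum (𝓞 ↥(maximalRealSubfield L)))
  (w : PlacesOver L v) (hw : IsCMField.complexConj L • w.1 = w.1)

section Inner

variable [MeasurableSpace (LocalRing L v)] [BorelSpace (LocalRing L v)]
  (μY : Measure ↥(HeisRing.skewPart (conjLocal L (IsCMField.complexConj L) v))) [μY.IsAddHaarMeasure] [μY.Regular]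
  (χ₁ : (LocalRing L v)ˣ →* ℂˣ)
  (δ : (LocalRing L v)ˣ) (hδ : conjLocal L (IsCMField.complexConj L) v (δ : LocalRing L v) = -(δ : LocalRing L v)) (hδv : Valued.v ((δ : LocalRing L v) w) = WithZero.exp (-1 : ℤ))

/-! ## §1 TRANSPORT of the sphere fibre to the fixed units -/

open scoped Classical in
include hw hδv in
omit [μY.IsAddHaarMeasure] [μY.Regular] in
/-- **`∫_{S₁} Ē(a − s) dμ⁻(s) = χ₁(−δ)⁻¹ · ∫_C χ₁(ĉ)⁻¹ · Ē(1 + u·c⁻¹) dν(c)`** with `u := −(a·δ⁻¹)` and `ν := μ⁻.map M⁻¹`, `M c = δc` (PART 1): `S₁ = M(C)` and on `C`,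
`a − δc = (−δ·c)·(1 + u·c⁻¹)` with `−δ·c` a unit, so `Ē(a − δc) = χ₁(−δ)⁻¹χ₁(ĉ)⁻¹Ē(1 + uc⁻¹)` (PART 1 `diteInv_units_mul`).  Valid for EVERY `a ∈ R`. [cite: Keys1984, §4–§5]
[cite: WeilBNT1967, Ch. II §5] -/
theorem setIntegral_sphere_diteInv_sub_eq (a : LocalRing L v) :
    ∫ s in {s : ↥(HeisRing.skewPart (conjLocal L (IsCMField.complexConj L) v)) | Valued.v ((s : LocalRing L v) w) = WithZero.exp (-1 : ℤ)},
        (fun r : LocalRing L v => if h : IsUnit r then (((χ₁ h.unit)⁻¹ : ℂˣ) : ℂ) else 0) (a - (s : LocalRing L v)) ∂μY =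
      (((χ₁ (-δ))⁻¹ : ℂˣ) : ℂ) *
        ∫ c in {c : ↥(HeisRing.fixedPart (conjLocal L (IsCMField.complexConj L) v)) | Valued.v ((c : LocalRing L v) w) = 1},
          (fun r : LocalRing L v => if h : IsUnit r then (((χ₁ h.unit)⁻¹ : ℂˣ) : ℂ) else 0) (c : LocalRing L v) *
            (fun r : LocalRing L v => if h : IsUnit r then (((χ₁ h.unit)⁻¹ : ℂˣ) : ℂ) else 0)
              (1 + -(a * ((δ⁻¹ : (LocalRing L v)ˣ) : LocalRing L v)) * ((c : LocalRing L v))⁻¹)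
          ∂(μY.map (HeisRing.mulSkewUnit (conjLocal L (IsCMField.complexConj L) v) δ hδ).symm) := by
  set M := HeisRing.mulSkewUnit (conjLocal L (IsCMField.complexConj L) v) δ hδ with hM
  set ν := μY.map M.symm with hν
  have hδ0 : Valued.v ((δ : LocalRing L v) w) ≠ 0 := by rw [hδv]; exact WithZero.exp_ne_zero
  -- `M⁻¹(S₁) = C`
  have hpre : M ⁻¹' {s : ↥(HeisRing.skewPart (conjLocal L (IsCMField.complexConj L) v)) | Valued.v ((s : LocalRing L v) w) = WithZero.exp (-1 : ℤ)} =
      {c : ↥(HeisRing.fixedPart (conjLocal L (IsCMField.complexConj L) v)) | Valued.v ((c : LocalRing L v) w) = 1} := by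
    ext c
    rw [Set.mem_preimage, Set.mem_setOf_eq, Set.mem_setOf_eq, hM, HeisRing.coe_mulSkewUnit, Pi.mul_apply, map_mul, hδv]
    exact mul_eq_left₀ WithZero.exp_ne_zero
  have key := (measurePreserving_mulSkewUnit L v μY δ hδ).setIntegral_preimage_emb M.toHomeomorph.measurableEmbedding
    (fun s : ↥(HeisRing.skewPart (conjLocal L (IsCMField.complexConj L) v)) =>
      (fun r : LocalRing L v => if h : IsUnit r then (((χ₁ h.unit)⁻¹ : ℂˣ) : ℂ) else 0) (a - (s : LocalRing L v)))
    {s : ↥(HeisRing.skewPart (conjLocal L (IsCMField.complexConj L) v)) | Valued.v ((s : LocalRing L v) w) = WithZero.exp (-1 : ℤ)}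
  rw [hpre] at key
  rw [← key, ← integral_const_mul]
  refine setIntegral_congr_fun (measurableSet_fixedUnits L v w).1 fun c hc => ?_
  rw [Set.mem_setOf_eq] at hc
  have hcU := isUnit_of_valued_eq_one L v w hw hc
  -- `a − δc = (−δ·ĉ)·(1 + u c⁻¹)`
  have hfac : a - ((M c : ↥(HeisRing.skewPart (conjLocal L (IsCMField.complexConj L) v))) : LocalRing L v) =
      (((-δ * hcU.unit : (LocalRing L v)ˣ)) : LocalRing L v) * (1 + -(a * ((δ⁻¹ : (LocalRing L v)ˣ) : LocalRing L v)) * ((c : LocalRing L v))⁻¹) := by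
    rw [hM, HeisRing.coe_mulSkewUnit, Units.val_mul, Units.val_neg, IsUnit.unit_spec]
    have h1 : (c : LocalRing L v) * ((c : LocalRing L v))⁻¹ = 1 := mul_inv_cancel_of_valued_eq_one L v w hw hc
    have h2 : (δ : LocalRing L v) * ((δ⁻¹ : (LocalRing L v)ˣ) : LocalRing L v) = 1 := Units.mul_inv δ
    linear_combination (-a) * h2 + (-(a * ((δ : LocalRing L v) * ((δ⁻¹ : (LocalRing L v)ˣ) : LocalRing L v)))) * h1
  show (fun r : LocalRing L v => if h : IsUnit r then (((χ₁ h.unit)⁻¹ : ℂˣ) : ℂ) else 0) (a - ((M c : ↥(HeisRing.skewPart _)) : LocalRing L v)) = _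
  rw [hfac, diteInv_units_mul L v χ₁ (-δ * hcU.unit), map_mul, mul_inv, Units.val_mul, mul_assoc, ← diteInv_units L v χ₁ hcU.unit, IsUnit.unit_spec]

/-! ## §2 THE INNER INTEGRAL `I(f) = ∫_C Ē(1 + u·f·c) dν(c)` for a fixed `f` with `|f_w| ≤ 1` -/

open scoped Classical in
include hw in
omit [μY.IsAddHaarMeasure] [μY.Regular] in
/-- On `𝔪⁺ = {c ∈ R⁺ : |c_w| < 1}` and for `|t_w| ≤ |ϖ|^m` with `t` arbitrary: `Ē(1 + t·c) = 1` — `|c| ≤ exp(−2)` (fixed parity, PART 1) puts `tc` at level `|ϖ|^(m+2) ≤ |ϖ|^(m+1)`, the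
conductor (`htriv` at `|ϖ|^(m+1)`).  Hence **`∫_{𝔪⁺} Ē(1 + t c) dν = ν(𝔪⁺)`** and likewise **`∫_C Ē(1 + t c) dν = ν(C)` when `|t_w| ≤ |ϖ|^(m+2)`**. [cite: Keys1984, §4] -/
theorem setIntegral_diteInv_one_add_mul_eq_measureReal (he : v.asIdeal.ramificationIdx' w.1.asIdeal ≠ 1)
    {ϖ : w.1.adicCompletion L} (hϖ : Valued.v ϖ = WithZero.exp (-1 : ℤ)) {m : ℕ}
    (htriv : ∀ u : (LocalRing L v)ˣ, Valued.v (((u : LocalRing L v) - 1) w) ≤ Valued.v ϖ ^ (m + 1) → χ₁ u = 1)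
    (ν : Measure ↥(HeisRing.fixedPart (conjLocal L (IsCMField.complexConj L) v))) {t : LocalRing L v} :
    (Valued.v (t w) ≤ Valued.v ϖ ^ m →
      ∫ c in {c : ↥(HeisRing.fixedPart (conjLocal L (IsCMField.complexConj L) v)) | Valued.v ((c : LocalRing L v) w) < 1},
          (fun r : LocalRing L v => if h : IsUnit r then (((χ₁ h.unit)⁻¹ : ℂˣ) : ℂ) else 0) (1 + t * (c : LocalRing L v)) ∂ν =
        (ν.real {c : ↥(HeisRing.fixedPart (conjLocal L (IsCMField.complexConj L) v)) | Valued.v ((c : LocalRing L v) w) < 1} : ℂ)) ∧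
    (Valued.v (t w) ≤ Valued.v ϖ ^ (m + 2) →
      ∫ c in {c : ↥(HeisRing.fixedPart (conjLocal L (IsCMField.complexConj L) v)) | Valued.v ((c : LocalRing L v) w) = 1},
          (fun r : LocalRing L v => if h : IsUnit r then (((χ₁ h.unit)⁻¹ : ℂˣ) : ℂ) else 0) (1 + t * (c : LocalRing L v)) ∂ν =
        (ν.real {c : ↥(HeisRing.fixedPart (conjLocal L (IsCMField.complexConj L) v)) | Valued.v ((c : LocalRing L v) w) = 1} : ℂ)) := by
  have hϖ1 : Valued.v ϖ ≤ 1 := by rw [hϖ, ← WithZero.exp_zero, WithZero.exp_le_exp]; norm_num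
  have hr : Valued.v ϖ ^ (m + 1) < 1 := by
    rw [pow_succ]
    exact lt_of_le_of_lt (mul_le_of_le_one_left' (pow_le_one' hϖ1 m)) (by rw [hϖ, ← WithZero.exp_zero, WithZero.exp_lt_exp]; norm_num)
  have hstep : Valued.v ϖ ^ (m + 2) ≤ Valued.v ϖ ^ (m + 1) := pow_le_pow_right_of_le_one' hϖ1 (by omega)
  have hϖ2 : WithZero.exp (-2 : ℤ) = Valued.v ϖ ^ 2 := by rw [hϖ, ← WithZero.exp_nsmul]; norm_num
  have hfix : ∀ c : ↥(HeisRing.fixedPart (conjLocal L (IsCMField.complexConj L) v)), conjLocal L (IsCMField.complexConj L) v (c : LocalRing L v) = c :=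
    fun c => (HeisRing.mem_fixedPart_iff _ _).1 c.2
  have hmeasC := (measurableSet_fixedUnits L v w).1
  have hmeasm : MeasurableSet {c : ↥(HeisRing.fixedPart (conjLocal L (IsCMField.complexConj L) v)) | Valued.v ((c : LocalRing L v) w) < 1} := by
    have h : {c : ↥(HeisRing.fixedPart (conjLocal L (IsCMField.complexConj L) v)) | Valued.v ((c : LocalRing L v) w) < 1} =
        (Subtype.val : ↥(HeisRing.fixedPart (conjLocal L (IsCMField.complexConj L) v)) → LocalRing L v) ⁻¹' {x : LocalRing L v | Valued.v (x w) < 1} := rfl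
    rw [h]
    exact ((isOpen_setOf_valued_apply_lt_one L v w).preimage continuous_subtype_val).measurableSet
  constructor
  · intro ht
    have hpt : ∀ c ∈ {c : ↥(HeisRing.fixedPart (conjLocal L (IsCMField.complexConj L) v)) | Valued.v ((c : LocalRing L v) w) < 1},
        (fun r : LocalRing L v => if h : IsUnit r then (((χ₁ h.unit)⁻¹ : ℂˣ) : ℂ) else 0) (1 + t * (c : LocalRing L v)) = (1 : ℂ) := by
      intro c hc
      rw [Set.mem_setOf_eq] at hc
      have hc2 : Valued.v ((c : LocalRing L v) w) ≤ Valued.v ϖ ^ 2 := by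
        rw [← hϖ2]; exact valued_le_exp_neg_two_of_fixed_of_lt_one L v w hw he (hfix c) hc
      refine diteInv_one_add_eq_one_of_le L v w hw χ₁ hr htriv ?_
      rw [Pi.mul_apply, map_mul]
      calc Valued.v (t w) * Valued.v ((c : LocalRing L v) w) ≤ Valued.v ϖ ^ m * Valued.v ϖ ^ 2 := mul_le_mul' ht hc2
        _ = Valued.v ϖ ^ (m + 2) := by rw [← pow_add]
        _ ≤ Valued.v ϖ ^ (m + 1) := hstep
    rw [setIntegral_congr_fun hmeasm hpt, setIntegral_const, Complex.real_smul, mul_one]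
  · intro ht
    have hpt : ∀ c ∈ {c : ↥(HeisRing.fixedPart (conjLocal L (IsCMField.complexConj L) v)) | Valued.v ((c : LocalRing L v) w) = 1},
        (fun r : LocalRing L v => if h : IsUnit r then (((χ₁ h.unit)⁻¹ : ℂˣ) : ℂ) else 0) (1 + t * (c : LocalRing L v)) = (1 : ℂ) := by
      intro c hc
      rw [Set.mem_setOf_eq] at hc
      refine diteInv_one_add_eq_one_of_le L v w hw χ₁ hr htriv ?_
      rw [Pi.mul_apply, map_mul, hc, mul_one]
      exact ht.trans hstep
    rw [setIntegral_congr_fun hmeasC hpt, setIntegral_const, Complex.real_smul, mul_one]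

open scoped Classical in
include hw in
/-- **THE BALL TERM VANISHES: `∫_{𝒪⁺} Ē(1 + t·c) dν(c) = 0`** for a SKEW `t` with `|t_w| = |ϖ|^m` (`1 ≤ m`), `χ₁` continuous, `hfixP`, `|2|_w = 1`, and a sharp witness `u₁` at
level `|ϖ|^m`: push `ν|_{𝒪⁺}` forward by `c ↦ t·c` (★ `mulSkewUnit`; `(t·)_*ν = k • μ⁻`, PART 1) onto the skew ball `{|y|_w ≤ |ϖ|^m}`, where ★ (5a)
`setIntegral_skewBall_pow_diteInv_one_add_eq_zero` gives `0`. [cite: Keys1984, §4–§5, §7 Theorem (2) (d) p. 126] [cite: WeilBNT1967, Ch. II §5] -/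
theorem setIntegral_fixedBall_diteInv_one_add_mul_eq_zero (h2w : Valued.v (2 : w.1.adicCompletion L) = 1) (h₁ : Continuous fun x => ((χ₁ x : ℂˣ) : ℂ))
    (hfixP : ∀ u : (LocalRing L v)ˣ, (∀ w' : PlacesOver L v, Valued.v (((u : LocalRing L v) w') - 1) < 1) →
      conjLocal L (IsCMField.complexConj L) v (u : LocalRing L v) = u → χ₁ u = 1)
    {ϖ : w.1.adicCompletion L} (hϖ : Valued.v ϖ = WithZero.exp (-1 : ℤ)) {m : ℕ} (hm : 1 ≤ m)
    (u₁ : (LocalRing L v)ˣ) (hu₁ : ∀ w' : PlacesOver L v, Valued.v (((u₁ : LocalRing L v) w') - 1) ≤ Valued.v ϖ ^ m) (hχu₁ : χ₁ u₁ ≠ 1)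
    (t : (LocalRing L v)ˣ) (ht : conjLocal L (IsCMField.complexConj L) v (t : LocalRing L v) = -(t : LocalRing L v))
    (htv : Valued.v ((t : LocalRing L v) w) = Valued.v ϖ ^ m) :
    ∫ c in {c : ↥(HeisRing.fixedPart (conjLocal L (IsCMField.complexConj L) v)) | Valued.v ((c : LocalRing L v) w) ≤ 1},
        (fun r : LocalRing L v => if h : IsUnit r then (((χ₁ h.unit)⁻¹ : ℂˣ) : ℂ) else 0) (1 + (t : LocalRing L v) * (c : LocalRing L v))
        ∂(μY.map (HeisRing.mulSkewUnit (conjLocal L (IsCMField.complexConj L) v) δ hδ).symm) = 0 := by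
  set ν := μY.map (HeisRing.mulSkewUnit (conjLocal L (IsCMField.complexConj L) v) δ hδ).symm with hν
  set Mt := HeisRing.mulSkewUnit (conjLocal L (IsCMField.complexConj L) v) t ht with hMt
  have ht0 : Valued.v ((t : LocalRing L v) w) ≠ 0 := by rw [htv]; exact pow_ne_zero _ (by rw [hϖ]; exact WithZero.exp_ne_zero)
  -- `Mt⁻¹{|y| ≤ |ϖ|^m} = 𝒪⁺`
  have hpre : Mt ⁻¹' {y : ↥(HeisRing.skewPart (conjLocal L (IsCMField.complexConj L) v)) | Valued.v ((y : LocalRing L v) w) ≤ Valued.v ϖ ^ m} =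
      {c : ↥(HeisRing.fixedPart (conjLocal L (IsCMField.complexConj L) v)) | Valued.v ((c : LocalRing L v) w) ≤ 1} := by
    ext c
    rw [Set.mem_preimage, Set.mem_setOf_eq, Set.mem_setOf_eq, hMt, HeisRing.coe_mulSkewUnit, Pi.mul_apply, map_mul, htv]
    have hϖm0 : Valued.v ϖ ^ m ≠ 0 := by rw [← htv]; exact ht0
    constructor
    · intro h
      calc Valued.v ((c : LocalRing L v) w) = (Valued.v ϖ ^ m)⁻¹ * (Valued.v ϖ ^ m * Valued.v ((c : LocalRing L v) w)) := by
            rw [← mul_assoc, inv_mul_cancel₀ hϖm0, one_mul]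
        _ ≤ (Valued.v ϖ ^ m)⁻¹ * Valued.v ϖ ^ m := mul_le_mul' le_rfl h
        _ = 1 := inv_mul_cancel₀ hϖm0
    · intro h
      calc Valued.v ϖ ^ m * Valued.v ((c : LocalRing L v) w) ≤ Valued.v ϖ ^ m * 1 := mul_le_mul' le_rfl h
        _ = Valued.v ϖ ^ m := mul_one _
  have hpres : MeasurePreserving Mt ν (ν.map Mt) := ⟨Mt.continuous.measurable, rfl⟩
  have key := hpres.setIntegral_preimage_emb Mt.toHomeomorph.measurableEmbedding
    (fun y : ↥(HeisRing.skewPart (conjLocal L (IsCMField.complexConj L) v)) =>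
      (fun r : LocalRing L v => if h : IsUnit r then (((χ₁ h.unit)⁻¹ : ℂˣ) : ℂ) else 0) (1 + (y : LocalRing L v)))
    {y : ↥(HeisRing.skewPart (conjLocal L (IsCMField.complexConj L) v)) | Valued.v ((y : LocalRing L v) w) ≤ Valued.v ϖ ^ m}
  rw [hpre] at key
  obtain ⟨k, hk⟩ := exists_map_mulSkewUnit_eq_smul L v μY δ hδ t ht
  have hval : ∀ c : ↥(HeisRing.fixedPart (conjLocal L (IsCMField.complexConj L) v)),
      (1 : LocalRing L v) + ((Mt c : ↥(HeisRing.skewPart (conjLocal L (IsCMField.complexConj L) v))) : LocalRing L v) = 1 + (t : LocalRing L v) * (c : LocalRing L v) := by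
    intro c; rw [hMt, HeisRing.coe_mulSkewUnit]
  simp_rw [hval] at key
  rw [key, hν, hk, Measure.restrict_smul, integral_smul_nnreal_measure]
  have h0 := setIntegral_skewBall_pow_diteInv_one_add_eq_zero L v w hw μY h2w χ₁ h₁ hfixP hϖ hm u₁ hu₁ hχu₁
  beta_reduce at h0
  rw [h0, smul_zero]

open scoped Classical in
include hw in
/-- **THE INNER INTEGRAL at `|f_w| = 1`: `∫_C Ē(1 + u·f·c) dν(c) = −ν(𝔪⁺)`** for a skew `u` with `|u_w| = |ϖ|^m`, a fixed `f` with `|f_w| = 1` (`C = 𝒪⁺ ∖ 𝔪⁺`; the `𝒪⁺`-term is `0`,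
the `𝔪⁺`-term is `ν(𝔪⁺)`). [cite: Keys1984, §4–§5] [cite: IrelandRosen1990, Ch. 8 §2] -/
theorem setIntegral_fixedUnits_diteInv_inner_eq_neg (he : v.asIdeal.ramificationIdx' w.1.asIdeal ≠ 1) (h2w : Valued.v (2 : w.1.adicCompletion L) = 1)
    (h₁ : Continuous fun x => ((χ₁ x : ℂˣ) : ℂ))
    (hfixP : ∀ u : (LocalRing L v)ˣ, (∀ w' : PlacesOver L v, Valued.v (((u : LocalRing L v) w') - 1) < 1) →
      conjLocal L (IsCMField.complexConj L) v (u : LocalRing L v) = u → χ₁ u = 1)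
    {ϖ : w.1.adicCompletion L} (hϖ : Valued.v ϖ = WithZero.exp (-1 : ℤ)) {m : ℕ} (hm : 1 ≤ m)
    (hcond : ∀ u : (LocalRing L v)ˣ, (∀ w' : PlacesOver L v, Valued.v (((u : LocalRing L v) w') - 1) ≤ Valued.v ϖ ^ (m + 1)) → χ₁ u = 1)
    (u₁ : (LocalRing L v)ˣ) (hu₁ : ∀ w' : PlacesOver L v, Valued.v (((u₁ : LocalRing L v) w') - 1) ≤ Valued.v ϖ ^ m) (hχu₁ : χ₁ u₁ ≠ 1)
    {u : LocalRing L v} (hu : conjLocal L (IsCMField.complexConj L) v u = -u) (huv : Valued.v (u w) = Valued.v ϖ ^ m)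
    {f : LocalRing L v} (hf : conjLocal L (IsCMField.complexConj L) v f = f) (hfv : Valued.v (f w) = 1) :
    ∫ c in {c : ↥(HeisRing.fixedPart (conjLocal L (IsCMField.complexConj L) v)) | Valued.v ((c : LocalRing L v) w) = 1},
        (fun r : LocalRing L v => if h : IsUnit r then (((χ₁ h.unit)⁻¹ : ℂˣ) : ℂ) else 0) (1 + u * f * (c : LocalRing L v))
        ∂(μY.map (HeisRing.mulSkewUnit (conjLocal L (IsCMField.complexConj L) v) δ hδ).symm) =
      -((μY.map (HeisRing.mulSkewUnit (conjLocal L (IsCMField.complexConj L) v) δ hδ).symm).real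
          {c : ↥(HeisRing.fixedPart (conjLocal L (IsCMField.complexConj L) v)) | Valued.v ((c : LocalRing L v) w) < 1} : ℂ) := by
  set ν := μY.map (HeisRing.mulSkewUnit (conjLocal L (IsCMField.complexConj L) v) δ hδ).symm with hν
  haveI : ν.IsAddHaarMeasure := isAddHaarMeasure_map_mulSkewUnit_symm L v μY δ hδ
  have hσc := continuous_conjLocal L (IsCMField.complexConj L) v
  haveI := HeisRing.locallyCompactSpace_fixedPart (conjLocal L (IsCMField.complexConj L) v) hσc
  -- the skew unit `t := u f` of level `|ϖ|^m`
  have htv : Valued.v ((u * f) w) = Valued.v ϖ ^ m := by rw [Pi.mul_apply, map_mul, huv, hfv, mul_one]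
  have ht0 : Valued.v ((u * f) w) ≠ 0 := by rw [htv]; exact pow_ne_zero _ (by rw [hϖ]; exact WithZero.exp_ne_zero)
  have htU : IsUnit (u * f) := K2E3DepthZeroIwahoriCharacterCM.isUnit_of_apply_ne_zero L v w hw _ ((Valuation.ne_zero_iff _).1 ht0)
  have htσ : conjLocal L (IsCMField.complexConj L) v (htU.unit : LocalRing L v) = -(htU.unit : LocalRing L v) := by
    rw [IsUnit.unit_spec, map_mul, hu, hf, neg_mul]
  have htriv : ∀ u' : (LocalRing L v)ˣ, Valued.v (((u' : LocalRing L v) - 1) w) ≤ Valued.v ϖ ^ (m + 1) → χ₁ u' = 1 :=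
    fun u' hu' => hcond u' (forall_placesOver_of_apply L v w hw hu')
  -- the three sets and `C = 𝒪⁺ ∖ 𝔪⁺`
  set C : Set ↥(HeisRing.fixedPart (conjLocal L (IsCMField.complexConj L) v)) := {c | Valued.v ((c : LocalRing L v) w) = 1} with hCdef
  set O : Set ↥(HeisRing.fixedPart (conjLocal L (IsCMField.complexConj L) v)) := {c | Valued.v ((c : LocalRing L v) w) ≤ 1} with hOdef
  set P : Set ↥(HeisRing.fixedPart (conjLocal L (IsCMField.complexConj L) v)) := {c | Valued.v ((c : LocalRing L v) w) < 1} with hPdef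
  have hPm : MeasurableSet P := by
    have h : P = (Subtype.val : ↥(HeisRing.fixedPart (conjLocal L (IsCMField.complexConj L) v)) → LocalRing L v) ⁻¹' {x : LocalRing L v | Valued.v (x w) < 1} := rfl
    rw [h]; exact ((isOpen_setOf_valued_apply_lt_one L v w).preimage continuous_subtype_val).measurableSet
  have hCOP : C = O \ P := by
    ext c; simp only [hCdef, hOdef, hPdef, Set.mem_setOf_eq, Set.mem_sdiff, not_lt]; exact ⟨fun h => ⟨h.le, h.ge⟩, fun h => le_antisymm h.1 h.2⟩
  have hPO : P ⊆ O := fun c hc => by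
    simp only [hPdef, hOdef, Set.mem_setOf_eq] at hc ⊢
    exact le_of_lt hc
  -- integrability on `O` (bounded by `1`, `O` of finite measure)
  have hOc : IsCompact O := by
    have h : O = (Subtype.val : ↥(HeisRing.fixedPart (conjLocal L (IsCMField.complexConj L) v)) → LocalRing L v) ⁻¹' {x : LocalRing L v | Valued.v (x w) ≤ 1} := rfl
    rw [h]
    exact (HeisRing.isClosed_fixedPart (conjLocal L (IsCMField.complexConj L) v) hσc).isClosedEmbedding_subtypeVal.isCompact_preimage
      (isCompact_setOf_valued_apply_le_one L v w hw)
  have h₁' : Continuous fun x => (((χ₁ x)⁻¹ : ℂˣ) : ℂ) := by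
    have h : (fun x => (((χ₁ x)⁻¹ : ℂˣ) : ℂ)) = fun x => (((χ₁ x : ℂˣ) : ℂ))⁻¹ := by funext x; rw [Units.val_inv_eq_inv_val]
    rw [h]; exact h₁.inv₀ fun x => Units.ne_zero _
  have hmeasF : Measurable fun c : ↥(HeisRing.fixedPart (conjLocal L (IsCMField.complexConj L) v)) =>
      (fun r : LocalRing L v => if h : IsUnit r then (((χ₁ h.unit)⁻¹ : ℂˣ) : ℂ) else 0) (1 + u * f * (c : LocalRing L v)) :=
    (measurable_dite_isUnit L v w hw (fun x => (((χ₁ x)⁻¹ : ℂˣ) : ℂ)) h₁').comp ((continuous_const.add (continuous_const.mul continuous_subtype_val)).measurable)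
  have hint : IntegrableOn (fun c : ↥(HeisRing.fixedPart (conjLocal L (IsCMField.complexConj L) v)) =>
      (fun r : LocalRing L v => if h : IsUnit r then (((χ₁ h.unit)⁻¹ : ℂˣ) : ℂ) else 0) (1 + u * f * (c : LocalRing L v))) O ν := by
    refine IntegrableOn.of_bound hOc.measure_lt_top hmeasF.aestronglyMeasurable.restrict 1 ?_
    refine (ae_restrict_mem hOc.isClosed.measurableSet).mono fun c hc => ?_
    have hsmall : Valued.v ((u * f * (c : LocalRing L v)) w) < 1 := by
      rw [Pi.mul_apply, map_mul, htv]
      calc Valued.v ϖ ^ m * Valued.v ((c : LocalRing L v) w) ≤ Valued.v ϖ ^ m * 1 := mul_le_mul' le_rfl hc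
        _ < 1 := by rw [mul_one]; exact (valued_pow_uniformizer L v w hϖ hm).2.2
    have hv1 : Valued.v ((1 + u * f * (c : LocalRing L v)) w) = 1 := by
      rw [Pi.add_apply, Pi.one_apply]; exact Valuation.map_one_add_of_lt _ hsmall
    exact norm_dite_apply_le_one L v w hw χ₁⁻¹ (by
      have h : (fun x => ((χ₁⁻¹ x : ℂˣ) : ℂ)) = fun x => (((χ₁ x)⁻¹ : ℂˣ) : ℂ) := by funext x; rw [MonoidHom.inv_apply]
      rw [h]; exact h₁') _ hv1 |>.trans_eq' (by
        show ‖(if h : IsUnit (1 + u * f * (c : LocalRing L v)) then (((χ₁ h.unit)⁻¹ : ℂˣ) : ℂ) else 0)‖ =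
          ‖(if h : IsUnit (1 + u * f * (c : LocalRing L v)) then ((χ₁⁻¹ h.unit : ℂˣ) : ℂ) else 0)‖
        by_cases hU : IsUnit (1 + u * f * (c : LocalRing L v))
        · rw [dif_pos hU, dif_pos hU, MonoidHom.inv_apply]
        · rw [dif_neg hU, dif_neg hU])
  rw [hCOP, setIntegral_sdiff hPm hint hPO]
  -- the `𝒪⁺`-term vanishes and the `𝔪⁺`-term is `ν(𝔪⁺)`
  have hO0 := setIntegral_fixedBall_diteInv_one_add_mul_eq_zero L v w hw μY χ₁ δ hδ h2w h₁ hfixP hϖ hm u₁ hu₁ hχu₁ htU.unit htσ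
    (by rw [IsUnit.unit_spec]; exact htv)
  rw [IsUnit.unit_spec] at hO0
  have hP1 := (setIntegral_diteInv_one_add_mul_eq_measureReal L v w hw χ₁ he hϖ htriv ν (t := u * f)).1 htv.le
  rw [hO0, hP1, zero_sub]

end Inner

end Summit.HodgeConjecture.HodgeConjecture.R90.S1.BposRamGaussSphereInner

end
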